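import Literature.AlgebraicGeometry.AbelianSchemes.PolarizedAbelianSchemeWithLevel
import HarnessLib

/-!
# Pull-backs of polarised abelian schemes with level structure are unique up to a unique isomorphism of triples

Topic `AlgebraicGeometry/AbelianSchemes`; namespace `Literature.AlgebraicGeometry.AbelianSchemes`; THEOREMS ONLY (no
definition, no named fact, no instance).  [MumfordFogartyKirwan1994, Ch. 7 §2 Def. 7.2] makes `𝒜_{g,d,n}` «a contravariant
functor … in the obvious way»: the value at `S` is the set of triples `(X, λ, σ)` UP TO ISOMORPHISM and `𝒜(f)` is pull-back
along `f : T → S`.  The tree records pull-back as a RELATION (★ D4 `PolarizedAbelianSchemeWithLevel.IsBaseChangeVia P' P f G Ĝ`: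
cartesian squares `G : X' → X`, `Ĝ : X̂' → X̂` compatible with the group laws, the Poincaré sheaves, `λ` and the level
sections; along `𝟙 S` it is «isomorphism of triples»), with `refl` and `trans` (★).  This file supplies the third
pseudo-functor axiom, WELL-DEFINEDNESS: **two pull-backs of the same triple along the same `f` are related along `𝟙 T`**
— the comparison isomorphisms of the two cartesian squares (Mathlib `IsPullback.isoIsPullback`) respect units,
multiplications and level sections (uniqueness of maps into a pull-back, `IsPullback.hom_ext`), the polarisations (same,
into `X̂₁ = X̂ ×_S T` — NOT by cancelling `Ĝ₁`, which is no monomorphism), and the Poincaré sheaves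
(`(H × Ĥ)^* (G₁ × Ĝ₁)^* 𝒫 ≅ (G₂ × Ĝ₂)^* 𝒫`, Mathlib `pullback.map_comp` + `Scheme.Modules.pullbackComp/pullbackCongr`).

* `AbelianSchemeOver.isBaseChangeVia_id_of_comp_eq` — if `A₁`, `A₂` are base changes of `A` along `f` via `G₁`, `G₂` and
  `H : X₂ ⟶ X₁` is an isomorphism over `T` with `H ≫ G₁ = G₂`, then `H` relates `A₂` to `A₁` along `𝟙 T` (as group schemes);
* `AbelianSchemeOver.IsBaseChangeVia.exists_iso_comp_eq` — such an `H` exists (the comparison of the two cartesian squares);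
* `AbelianSchemeOver.LevelStructure.isBaseChangeVia_id_of_comp_eq` — the same with level sections;
* **`PolarizedAbelianSchemeWithLevel.IsBaseChangeVia.exists_isBaseChangeVia_id_of_isBaseChangeVia`** — THE HEAD:
  `P₁.IsBaseChangeVia P f G₁ Ĝ₁ → P₂.IsBaseChangeVia P f G₂ Ĝ₂ → ∃ H Ĥ, P₂.IsBaseChangeVia P₁ (𝟙 T) H Ĥ`, in the strong
  form recording `IsIso H`, `IsIso Ĥ`, `H ≫ G₁ = G₂`, `Ĥ ≫ Ĝ₁ = Ĝ₂` (`…_id`, and the bare-existence corollary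
  `exists_isBaseChangeVia_id`).
This is the «fine moduli ⇒ injective on isomorphism classes» half that D4's `classify : ∃! f, ∃ G Ĝ, …` does not spell out:
two triples over `T` with the same classifying morphism are isomorphic (cell hodgecm-mathlib (U)-head glue, leaf L4).

## References
* [MumfordFogartyKirwan1994] D. Mumford, J. Fogarty, F. Kirwan, *Geometric Invariant Theory*, 3rd ed. (1994), Ch. 7 §2
  Definition 7.2 (p. 129) (the moduli functor; pull-back «in the obvious way»), Definition 7.3 (p. 129).
* [GortzWedhorn2020] U. Görtz, T. Wedhorn, *Algebraic Geometry I*, 2nd ed. (2020), Prop. 4.16 (p. 101) and (4.7)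
  (pp. 107–108) (fibre products are unique up to unique isomorphism; transitivity of base change).
-/

set_option autoImplicit false

universe u

open CategoryTheory CategoryTheory.Limits AlgebraicGeometry MonoidalCategory
open scoped MonObj

noncomputable section

namespace Literature.AlgebraicGeometry.AbelianSchemes

namespace AbelianSchemeOver

variable {S T : Scheme.{u}} {A : AbelianSchemeOver S} {A₁ A₂ : AbelianSchemeOver T} {f : T ⟶ S}
  {G₁ : A₁.X.left ⟶ A.X.left} {G₂ : A₂.X.left ⟶ A.X.left}

/-! ### §1 Group schemes: the comparison of two base changes along the same map -/

/-- **Two base changes of `A` along the same `f : T → S` are related along `𝟙 T` by any isomorphism over `T`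
commuting with the comparison maps** ([MumfordFogartyKirwan1994] Def. 7.2 «in the obvious way»; [GortzWedhorn2020]
Prop. 4.16): if `G₁ : X₁ → X`, `G₂ : X₂ → X` exhibit `A₁`, `A₂` as base changes of `A` along `f` (cartesian, compatible
with units and multiplications) and `H : X₂ ⟶ X₁` is an isomorphism with `H ≫ G₁ = G₂` and `H ≫ π₁ = π₂`, then `H`
exhibits `A₂` as the base change of `A₁` along `𝟙 T`: the square `(H, 𝟙)` is cartesian (`H` iso), and the unit /
multiplication clauses hold because both sides agree after `G₁` (by the clauses of `G₁`, `G₂` and Mathlib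
`pullback.map_comp`) and after `π₁`, i.e. as maps into the pull-back `X₁ = X ×_S T` (`IsPullback.hom_ext`).
[cite: MumfordFogartyKirwan1994, Ch. 7 §2 Definition 7.2 (p. 129)] [cite: GortzWedhorn2020, Prop. 4.16 (p. 101)] -/
theorem isBaseChangeVia_id_of_comp_eq (h₁ : A₁.IsBaseChangeVia A f G₁) (h₂ : A₂.IsBaseChangeVia A f G₂)
    (H : A₂.X.left ⟶ A₁.X.left) [IsIso H] (hHG : H ≫ G₁ = G₂) (hHw : H ≫ A₁.X.hom = A₂.X.hom) :
    A₂.IsBaseChangeVia A₁ (𝟙 T) H := by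
  obtain ⟨w₁, hpb₁, hη₁, hμ₁⟩ := h₁
  obtain ⟨w₂, hpb₂, hη₂, hμ₂⟩ := h₂
  have w : H ≫ A₁.X.hom = A₂.X.hom ≫ 𝟙 T := by rw [Category.comp_id, hHw]
  refine ⟨w, IsPullback.of_horiz_isIso ⟨w⟩, ?_, ?_⟩
  · -- units: compare after `G₁` and after `π₁` (`erw`: the unit's source is `(𝟙_ (Over T)).left`, which is `T`
    -- only definitionally)
    have l : (η[A₂.X].left ≫ H) ≫ G₁ = f ≫ η[A.X].left := by
      erw [Category.assoc, hHG]; exact hη₂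
    have r : (𝟙 T ≫ η[A₁.X].left) ≫ G₁ = f ≫ η[A.X].left := by
      erw [Category.id_comp]; exact hη₁
    have l' : (η[A₂.X].left ≫ H) ≫ A₁.X.hom = (𝟙_ (Over T)).hom := by
      erw [Category.assoc, hHw]; exact Over.w η[A₂.X]
    have r' : (𝟙 T ≫ η[A₁.X].left) ≫ A₁.X.hom = (𝟙_ (Over T)).hom := by
      erw [Category.id_comp]; exact Over.w η[A₁.X]
    exact hpb₁.hom_ext (l.trans r.symm) (l'.trans r'.symm)
  · -- multiplications: compare after `G₁` and after `π₁` (`(X ⊗ X).left = pullback π π` only definitionally)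
    have l : (μ[A₂.X].left ≫ H) ≫ G₁ =
        pullback.map A₂.X.hom A₂.X.hom A.X.hom A.X.hom G₂ G₂ f w₂.symm w₂.symm ≫ μ[A.X].left := by
      erw [Category.assoc, hHG]; exact hμ₂
    have hmaps : pullback.map A₂.X.hom A₂.X.hom A₁.X.hom A₁.X.hom H H (𝟙 T) w.symm w.symm ≫
          pullback.map A₁.X.hom A₁.X.hom A.X.hom A.X.hom G₁ G₁ f w₁.symm w₁.symm =
        pullback.map A₂.X.hom A₂.X.hom A.X.hom A.X.hom G₂ G₂ f w₂.symm w₂.symm := by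
      apply pullback.hom_ext
      · simp only [Category.assoc, pullback.lift_fst, pullback.lift_fst_assoc, hHG]
      · simp only [Category.assoc, pullback.lift_snd, pullback.lift_snd_assoc, hHG]
    have r : (pullback.map A₂.X.hom A₂.X.hom A₁.X.hom A₁.X.hom H H (𝟙 T) w.symm w.symm ≫ μ[A₁.X].left) ≫ G₁ =
        pullback.map A₂.X.hom A₂.X.hom A.X.hom A.X.hom G₂ G₂ f w₂.symm w₂.symm ≫ μ[A.X].left := by
      erw [Category.assoc, hμ₁, ← Category.assoc, hmaps]
    have l' : (μ[A₂.X].left ≫ H) ≫ A₁.X.hom = (A₂.X ⊗ A₂.X).hom := by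
      erw [Category.assoc, hHw]; exact Over.w μ[A₂.X]
    have r' : (pullback.map A₂.X.hom A₂.X.hom A₁.X.hom A₁.X.hom H H (𝟙 T) w.symm w.symm ≫ μ[A₁.X].left) ≫
        A₁.X.hom = (A₂.X ⊗ A₂.X).hom := by
      erw [Category.assoc, Over.w μ[A₁.X], Over.tensorObj_hom, Over.tensorObj_hom, pullback.lift_fst_assoc,
        Category.assoc, hHw]
    exact hpb₁.hom_ext (l.trans r.symm) (l'.trans r'.symm)

/-- **The comparison isomorphism of two base changes along the same map** (Mathlib `IsPullback.isoIsPullback` on the two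
cartesian squares over the cospan `X → S ← T`): `H : X₂ ≅ X₁` with `H ≫ G₁ = G₂` and `H ≫ π₁ = π₂`.
[cite: GortzWedhorn2020, Prop. 4.16 (p. 101)] -/
theorem IsBaseChangeVia.exists_iso_comp_eq (h₁ : A₁.IsBaseChangeVia A f G₁) (h₂ : A₂.IsBaseChangeVia A f G₂) :
    ∃ H : A₂.X.left ≅ A₁.X.left, H.hom ≫ G₁ = G₂ ∧ H.hom ≫ A₁.X.hom = A₂.X.hom := by
  obtain ⟨-, hpb₁, -, -⟩ := h₁
  obtain ⟨-, hpb₂, -, -⟩ := h₂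
  exact ⟨hpb₂.isoIsPullback _ _ hpb₁, hpb₂.isoIsPullback_hom_fst _ _ hpb₁, hpb₂.isoIsPullback_hom_snd _ _ hpb₁⟩

/-- **Hence two base changes of `A` along the same `f` are related along `𝟙 T`** by an isomorphism `H` with `H ≫ G₁ = G₂`.
[cite: MumfordFogartyKirwan1994, Ch. 7 §2 Definition 7.2 (p. 129)] [cite: GortzWedhorn2020, Prop. 4.16 (p. 101)] -/
theorem IsBaseChangeVia.exists_isBaseChangeVia_id (h₁ : A₁.IsBaseChangeVia A f G₁) (h₂ : A₂.IsBaseChangeVia A f G₂) :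
    ∃ H : A₂.X.left ⟶ A₁.X.left, IsIso H ∧ H ≫ G₁ = G₂ ∧ A₂.IsBaseChangeVia A₁ (𝟙 T) H := by
  obtain ⟨H, hHG, hHw⟩ := h₁.exists_iso_comp_eq h₂
  exact ⟨H.hom, inferInstance, hHG, isBaseChangeVia_id_of_comp_eq h₁ h₂ H.hom hHG hHw⟩

/-! ### §2 Level structures -/

namespace LevelStructure

variable {g n : ℕ} {φ : A.LevelStructure g n} {φ₁ : A₁.LevelStructure g n} {φ₂ : A₂.LevelStructure g n}

/-- **Two pull-backs of a level structure along the same `f` are related along `𝟙 T` by the comparison isomorphism**: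
the level sections agree after `G₁` (`σ₂ᵢ ≫ G₂ = f ≫ σᵢ = σ₁ᵢ ≫ G₁`) and over `T`, i.e. as maps into `X₁ = X ×_S T`.
[cite: MumfordFogartyKirwan1994, Ch. 7 §2 Definition 7.2 (p. 129)] -/
theorem isBaseChangeVia_id_of_comp_eq (h₁ : φ₁.IsBaseChangeVia φ f G₁) (h₂ : φ₂.IsBaseChangeVia φ f G₂)
    (H : A₂.X.left ⟶ A₁.X.left) [IsIso H] (hHG : H ≫ G₁ = G₂) (hHw : H ≫ A₁.X.hom = A₂.X.hom) :
    φ₂.IsBaseChangeVia φ₁ (𝟙 T) H := by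
  refine ⟨AbelianSchemeOver.isBaseChangeVia_id_of_comp_eq h₁.1 h₂.1 H hHG hHw, fun i => ?_⟩
  obtain ⟨-, hpb₁, -, -⟩ := h₁.1
  have l : ((φ₂.σ i).left ≫ H) ≫ G₁ = f ≫ (φ.σ i).left := by
    erw [Category.assoc, hHG]; exact h₂.2 i
  have r : (𝟙 T ≫ (φ₁.σ i).left) ≫ G₁ = f ≫ (φ.σ i).left := by
    erw [Category.id_comp]; exact h₁.2 i
  have l' : ((φ₂.σ i).left ≫ H) ≫ A₁.X.hom = (𝟙_ (Over T)).hom := by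
    erw [Category.assoc, hHw]; exact Over.w (φ₂.σ i)
  have r' : (𝟙 T ≫ (φ₁.σ i).left) ≫ A₁.X.hom = (𝟙_ (Over T)).hom := by
    erw [Category.id_comp]; exact Over.w (φ₁.σ i)
  exact hpb₁.hom_ext (l.trans r.symm) (l'.trans r'.symm)

/-- **Hence two pull-backs of a level structure along the same `f` are related along `𝟙 T`.**
[cite: MumfordFogartyKirwan1994, Ch. 7 §2 Definition 7.2 (p. 129)] -/
theorem IsBaseChangeVia.exists_isBaseChangeVia_id (h₁ : φ₁.IsBaseChangeVia φ f G₁)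
    (h₂ : φ₂.IsBaseChangeVia φ f G₂) :
    ∃ H : A₂.X.left ⟶ A₁.X.left, IsIso H ∧ H ≫ G₁ = G₂ ∧ φ₂.IsBaseChangeVia φ₁ (𝟙 T) H := by
  obtain ⟨H, hHG, hHw⟩ := h₁.1.exists_iso_comp_eq h₂.1
  exact ⟨H.hom, inferInstance, hHG, isBaseChangeVia_id_of_comp_eq h₁ h₂ H.hom hHG hHw⟩

end LevelStructure

end AbelianSchemeOver

/-! ### §3 Triples: the pull-back is unique up to an isomorphism of triples -/

namespace PolarizedAbelianSchemeWithLevel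

variable {g N : ℕ} {δ : Fin g → ℕ} {S T : Scheme.{u}} {P : PolarizedAbelianSchemeWithLevel g N δ S}
  {P₁ P₂ : PolarizedAbelianSchemeWithLevel g N δ T} {f : T ⟶ S}
  {G₁ : P₁.A.X.left ⟶ P.A.X.left} {Ĝ₁ : P₁.D.hat.X.left ⟶ P.D.hat.X.left}
  {G₂ : P₂.A.X.left ⟶ P.A.X.left} {Ĝ₂ : P₂.D.hat.X.left ⟶ P.D.hat.X.left}

/-- **PULL-BACKS OF TRIPLES ARE UNIQUE UP TO AN ISOMORPHISM OF TRIPLES** ([MumfordFogartyKirwan1994] Def. 7.2: `𝒜(f)` is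
well defined on isomorphism classes).  If `(G₁, Ĝ₁)` and `(G₂, Ĝ₂)` exhibit `P₁` and `P₂` as pull-backs of `P` along the
same `f : T → S`, then the comparison isomorphisms `H : X₂ ≅ X₁`, `Ĥ : X̂₂ ≅ X̂₁` of the cartesian squares (with
`H ≫ G₁ = G₂`, `Ĥ ≫ Ĝ₁ = Ĝ₂`) exhibit `P₂` as the pull-back of `P₁` along `𝟙 T`: the level / `X`-clause and the
`X̂`-clause by §§1–2; the `λ`-clause `λ₂ ≫ Ĥ = H ≫ λ₁` as maps into `X̂₁ = X̂ ×_S T` (after `Ĝ₁` both are `G₂ ≫ λ`, over `T`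
both are `π₂`); the Poincaré clause `(H × Ĥ)^* 𝒫₁ ≅ (H × Ĥ)^* (G₁ × Ĝ₁)^* 𝒫 ≅ (G₂ × Ĝ₂)^* 𝒫 ≅ 𝒫₂`
(`pullback.map_comp`, `Scheme.Modules.pullbackComp`/`pullbackCongr`). [cite: MumfordFogartyKirwan1994, Ch. 7 §2 Definition 7.2 (p. 129) and Definition 7.3 (p. 129)]
[cite: GortzWedhorn2020, Prop. 4.16 (p. 101) and Section (4.7) (pp. 107–108)] -/
theorem IsBaseChangeVia.exists_isBaseChangeVia_id_of_isBaseChangeVia (h₁ : P₁.IsBaseChangeVia P f G₁ Ĝ₁)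
    (h₂ : P₂.IsBaseChangeVia P f G₂ Ĝ₂) :
    ∃ (H : P₂.A.X.left ⟶ P₁.A.X.left) (Ĥ : P₂.D.hat.X.left ⟶ P₁.D.hat.X.left),
      IsIso H ∧ IsIso Ĥ ∧ H ≫ G₁ = G₂ ∧ Ĥ ≫ Ĝ₁ = Ĝ₂ ∧ P₂.IsBaseChangeVia P₁ (𝟙 T) H Ĥ := by
  obtain ⟨hl₁, hh₁, ⟨wG₁, wĜ₁, ⟨e₁⟩⟩, hlam₁⟩ := h₁
  obtain ⟨hl₂, hh₂, ⟨wG₂, wĜ₂, ⟨e₂⟩⟩, hlam₂⟩ := h₂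
  -- the comparison isomorphisms of the `X`- and `X̂`-squares
  obtain ⟨H, hHG, hHw⟩ := hl₁.1.exists_iso_comp_eq hl₂.1
  obtain ⟨Ĥ, hĤG, hĤw⟩ := hh₁.exists_iso_comp_eq hh₂
  obtain ⟨-, hpbh₁, -, -⟩ := id hh₁
  have wG : P₂.A.X.hom ≫ 𝟙 T = H.hom ≫ P₁.A.X.hom := by rw [Category.comp_id, hHw]
  have wĜ : P₂.D.hat.X.hom ≫ 𝟙 T = Ĥ.hom ≫ P₁.D.hat.X.hom := by rw [Category.comp_id, hĤw]
  refine ⟨H.hom, Ĥ.hom, inferInstance, inferInstance, hHG, hĤG,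
    AbelianSchemeOver.LevelStructure.isBaseChangeVia_id_of_comp_eq hl₁ hl₂ H.hom hHG hHw,
    AbelianSchemeOver.isBaseChangeVia_id_of_comp_eq hh₁ hh₂ Ĥ.hom hĤG hĤw, ⟨wG, wĜ, ⟨?_⟩⟩, ?_⟩
  · -- Poincaré: `(H × Ĥ)^* 𝒫₁ ≅ (H × Ĥ)^* (G₁ × Ĝ₁)^* 𝒫 ≅ ((H × Ĥ) ≫ (G₁ × Ĝ₁))^* 𝒫 = (G₂ × Ĝ₂)^* 𝒫 ≅ 𝒫₂`
    have hcomp : pullback.map P₂.A.X.hom P₂.D.hat.X.hom P₁.A.X.hom P₁.D.hat.X.hom H.hom Ĥ.hom (𝟙 T) wG wĜ ≫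
          pullback.map P₁.A.X.hom P₁.D.hat.X.hom P.A.X.hom P.D.hat.X.hom G₁ Ĝ₁ f wG₁ wĜ₁ =
        pullback.map P₂.A.X.hom P₂.D.hat.X.hom P.A.X.hom P.D.hat.X.hom G₂ Ĝ₂ f wG₂ wĜ₂ := by
      apply pullback.hom_ext
      · rw [Category.assoc, pullback.lift_fst, ← Category.assoc, pullback.lift_fst, Category.assoc, hHG,
          pullback.lift_fst]
      · rw [Category.assoc, pullback.lift_snd, ← Category.assoc, pullback.lift_snd, Category.assoc, hĤG,
          pullback.lift_snd]
    exact (Scheme.Modules.pullback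
        (pullback.map P₂.A.X.hom P₂.D.hat.X.hom P₁.A.X.hom P₁.D.hat.X.hom H.hom Ĥ.hom (𝟙 T) wG wĜ)).mapIso e₁.symm ≪≫
      (Scheme.Modules.pullbackComp
        (pullback.map P₂.A.X.hom P₂.D.hat.X.hom P₁.A.X.hom P₁.D.hat.X.hom H.hom Ĥ.hom (𝟙 T) wG wĜ)
        (pullback.map P₁.A.X.hom P₁.D.hat.X.hom P.A.X.hom P.D.hat.X.hom G₁ Ĝ₁ f wG₁ wĜ₁)).app P.D.P ≪≫
      (Scheme.Modules.pullbackCongr hcomp).app P.D.P ≪≫ e₂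
  · -- `λ`: compare after `Ĝ₁` and over `T`, i.e. as maps into `X̂₁ = X̂ ×_S T`
    apply hpbh₁.hom_ext
    · rw [Category.assoc, hĤG, hlam₂, Category.assoc, hlam₁, ← Category.assoc, hHG]
    · rw [Category.assoc, hĤw, Category.assoc, Over.w P₁.pol.lam, hHw, Over.w P₂.pol.lam]

/-- **Two pull-backs of a triple along the same map are isomorphic as triples** (the bare form of the head, = leaf L4 of
the cell's (U)-head glue: `P₁.IsBaseChangeVia P f G₁ Ĝ₁ → P₂.IsBaseChangeVia P f G₂ Ĝ₂ → ∃ H Ĥ, P₂.IsBaseChangeVia P₁ (𝟙 T) H Ĥ`).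
[cite: MumfordFogartyKirwan1994, Ch. 7 §2 Definition 7.2 (p. 129)] -/
theorem IsBaseChangeVia.exists_isBaseChangeVia_id (h₁ : P₁.IsBaseChangeVia P f G₁ Ĝ₁)
    (h₂ : P₂.IsBaseChangeVia P f G₂ Ĝ₂) :
    ∃ (H : P₂.A.X.left ⟶ P₁.A.X.left) (Ĥ : P₂.D.hat.X.left ⟶ P₁.D.hat.X.left),
      P₂.IsBaseChangeVia P₁ (𝟙 T) H Ĥ := by
  obtain ⟨H, Ĥ, -, -, -, -, h⟩ := h₁.exists_isBaseChangeVia_id_of_isBaseChangeVia h₂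
  exact ⟨H, Ĥ, h⟩

end PolarizedAbelianSchemeWithLevel

end Literature.AlgebraicGeometry.AbelianSchemes

end
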